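import Summits.CriticalPhenomena.PercolationContinuityZ3.Theorems.PercNearOneGluingNoHeavyQuantFarBundleCount
import HarnessLib

/-!
# QUANT lane R8, front "FAR beyond trees", layer one — the BUNDLE DICHOTOMY, graph side IIIb: the pocket probabilities

builds on p205010 (kernel theorem, internal audit signed; external expert review pending)

Support file (`--supports stmt-CriticalPhenomena-4575`), seat `prim-quant-p1` (gen 18); memo
`run/shared/lean/prim/quant/prim-quant-p1-g18/FOR-LEAD-UNICYCLIC-TREES.md` §1 (kernel plan §6, file F-B part 3b).
Standard axioms; no sorries; no definitions.

The pocket count `X = #{ℓ ∈ Lf : pocket ℓ}` of parts I–II is a function of the independent pairs `s(p,u)` (weight `a`), `s(p,ℓ₁)` (weight `b`)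
and `s(u,ℓ)` (weights `q ℓ`).  Its law in the two situations that occur:
* CURRENT / GLUED bundle (`b = 0`): `P(X ≥ 1) = a (1 − z0 Lf q)`, `P(X ≥ 2) = a (1 − z0 Lf q − z1 Lf q)`, `P(pocket ℓ) = a · q ℓ`
  (`Bundle.real_X1_of_b0`, `real_X2_of_b0`, `real_pocket_of_b0`);
* DETACHED bundle (`q ℓ₁ = 0`, `I = Lf ∖ ℓ₁`): `P(X ≥ 1) = 1 − (1 − b)(1 − a (1 − z0 I q))`,
  `P(X ≥ 2) = b · a (1 − z0 I q) + (1 − b) · a (1 − z0 I q − z1 I q)`, `P(pocket ℓ₁) = b`, `P(pocket ℓ) = a · q ℓ` (`ℓ ∈ I`)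
  (`Bundle.real_X1_of_c0`, `real_X2_of_c0`, `real_pocket_l1_of_c0`, `real_pocket_of_c0`).
[cite: Grimmett1999, §1.3 p. 10; §2.2] (product measure, cylinder events); bookkeeping [this work].
-/

noncomputable section

namespace Summit.CriticalPhenomena.PercolationContinuityZ3.Theorems

namespace Quant

namespace Bundle

open Finset MeasureTheory Set
open Literature.Probability.LatticeModels
open Literature.Probability.Percolation
open scoped Classical

variable {n : ℕ}

/-! ## The pocket count: current / glued bundle (`s(p,ℓ₁)` of weight `0`) -/

section Pocket

variable {o p u ℓ₁ : Fin n} {Lf : Finset (Fin n)} (H : IsPocket o p u ℓ₁ Lf) (v : Sym2 (Fin n) → unitInterval)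
include H

/-- The parent pair is not a leaf pair. [this work] -/
theorem parentPair_notMem_image (L : Finset (Fin n)) (hL : L ⊆ Lf) : s(p, u) ∉ L.image fun ℓ => s(u, ℓ) := by
  intro h
  obtain ⟨ℓ, hℓ, he⟩ := mem_image.1 h
  -- `he : s(u, ℓ) = s(p, u)`
  rcases Sym2.eq_iff.1 he with ⟨h1, -⟩ | ⟨-, h2⟩
  · exact H.pu h1.symm
  · exact H.pL (by rw [← h2]; exact hL hℓ)

/-- The pair `s(p,ℓ₁)` is not a leaf pair. [this work] -/
theorem l1Pair_notMem_image (L : Finset (Fin n)) (hL : L ⊆ Lf) : s(p, ℓ₁) ∉ L.image fun ℓ => s(u, ℓ) := by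
  intro h
  obtain ⟨ℓ, hℓ, he⟩ := mem_image.1 h
  have _ := hL hℓ
  -- `he : s(u, ℓ) = s(p, ℓ₁)`
  rcases Sym2.eq_iff.1 he with ⟨h1, -⟩ | ⟨h1, -⟩
  · exact H.pu h1.symm
  · exact H.uL (by rw [h1]; exact H.l1)

omit H in
/-- With `s(p,ℓ₁)` closed, the pocket filter is the leaf filter when `s(p,u)` is open and empty otherwise. [this work] -/
theorem pocket_filter_of_b0 {ω : BondConfig (Fin n)} (hb : s(p, ℓ₁) ∉ ω) :
    (Lf.filter fun ℓ => pocket p u ℓ₁ ω ℓ) = if s(p, u) ∈ ω then Lf.filter fun ℓ => s(u, ℓ) ∈ ω else ∅ := by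
  by_cases hpu : s(p, u) ∈ ω
  · rw [if_pos hpu]
    refine filter_congr fun ℓ _ => ?_
    simp only [pocket, connU, hpu, hb, true_and, false_and, and_false, or_false]
  · rw [if_neg hpu, filter_eq_empty_iff]
    intro ℓ _ h
    rcases h with ⟨hc, -⟩ | ⟨-, h2⟩
    · rcases hc with h | ⟨h, -⟩
      · exact hpu h
      · exact hb h
    · exact hb h2

/-- CURRENT/GLUED: `P(X ≥ 1) = a · (1 − z0 Lf q)`. [this work] -/
theorem real_X1_of_b0 (hb : (v s(p, ℓ₁) : ℝ) = 0) :
    (prodBernoulli v).real {ω : BondConfig (Fin n) | 1 ≤ (Lf.filter fun ℓ => pocket p u ℓ₁ ω ℓ).card} =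
      (v s(p, u) : ℝ) * (1 - z0 Lf (fun ℓ => (v s(u, ℓ) : ℝ))) := by
  have h1 : (prodBernoulli v).real {ω : BondConfig (Fin n) | 1 ≤ (Lf.filter fun ℓ => pocket p u ℓ₁ ω ℓ).card} =
      (prodBernoulli v).real ({ω | s(p, u) ∈ ω} ∩ {ω | 1 ≤ (Lf.filter fun ℓ => s(u, ℓ) ∈ ω).card}) := by
    refine real_congr_of_null v hb _ _ fun ω hω => ?_
    simp only [mem_setOf_eq, Set.mem_inter_iff, pocket_filter_of_b0 hω]
    by_cases hpu : s(p, u) ∈ ω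
    · simp [hpu]
    · simp [hpu]
  rw [h1, real_mem_inter v _ (parentPair_notMem_image H Lf (Finset.Subset.refl Lf)) (determinedBy_count u Lf fun k => 1 ≤ k),
    real_count_ge_one_eq v u Lf H.uL]

/-- CURRENT/GLUED: `P(X ≥ 2) = a · (1 − z0 Lf q − z1 Lf q)`. [this work] -/
theorem real_X2_of_b0 (hb : (v s(p, ℓ₁) : ℝ) = 0) :
    (prodBernoulli v).real {ω : BondConfig (Fin n) | 2 ≤ (Lf.filter fun ℓ => pocket p u ℓ₁ ω ℓ).card} =
      (v s(p, u) : ℝ) * (1 - z0 Lf (fun ℓ => (v s(u, ℓ) : ℝ)) - z1 Lf (fun ℓ => (v s(u, ℓ) : ℝ))) := by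
  have h1 : (prodBernoulli v).real {ω : BondConfig (Fin n) | 2 ≤ (Lf.filter fun ℓ => pocket p u ℓ₁ ω ℓ).card} =
      (prodBernoulli v).real ({ω | s(p, u) ∈ ω} ∩ {ω | 2 ≤ (Lf.filter fun ℓ => s(u, ℓ) ∈ ω).card}) := by
    refine real_congr_of_null v hb _ _ fun ω hω => ?_
    simp only [mem_setOf_eq, Set.mem_inter_iff, pocket_filter_of_b0 hω]
    by_cases hpu : s(p, u) ∈ ω
    · simp [hpu]
    · simp [hpu]
  rw [h1, real_mem_inter v _ (parentPair_notMem_image H Lf (Finset.Subset.refl Lf)) (determinedBy_count u Lf fun k => 2 ≤ k),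
    real_count_ge_two_eq v u Lf H.uL]

/-- CURRENT/GLUED: marginal pocket probability `P(pocket ℓ) = a · q ℓ` for `ℓ ∈ Lf`. [this work] -/
theorem real_pocket_of_b0 (hb : (v s(p, ℓ₁) : ℝ) = 0) {ℓ : Fin n} (hℓ : ℓ ∈ Lf) :
    (prodBernoulli v).real {ω : BondConfig (Fin n) | pocket p u ℓ₁ ω ℓ} = (v s(p, u) : ℝ) * (v s(u, ℓ) : ℝ) := by
  have h1 : (prodBernoulli v).real {ω : BondConfig (Fin n) | pocket p u ℓ₁ ω ℓ} =
      (prodBernoulli v).real ({ω | s(p, u) ∈ ω} ∩ {ω | s(u, ℓ) ∈ ω}) := by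
    refine real_congr_of_null v hb _ _ fun ω hω => ?_
    simp only [mem_setOf_eq, Set.mem_inter_iff, pocket, connU, hω, false_and, or_false, and_false]
  have hne : s(p, u) ∉ ({s(u, ℓ)} : Finset (Sym2 (Fin n))) := by
    rw [Finset.mem_singleton]
    intro he
    rcases Sym2.eq_iff.1 he with ⟨h1, -⟩ | ⟨h1, -⟩
    · exact H.pu h1
    · exact H.pL (by rw [h1]; exact hℓ)
  rw [h1, real_mem_inter v _ hne (var2083_det_mem _), prodBernoulli_real_setOf_mem]

/-! ## The pocket count: detached bundle (`s(u,ℓ₁)` of weight `0`) -/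

/-- With `s(u,ℓ₁)` closed: `pocket ℓ₁ ↔ s(p,ℓ₁) open`, and for `ℓ ≠ ℓ₁`: `pocket ℓ ↔ s(p,u), s(u,ℓ) open`. [this work] -/
theorem pocket_iff_of_c0 {ω : BondConfig (Fin n)} (hc : s(u, ℓ₁) ∉ ω) (ℓ : Fin n) :
    pocket p u ℓ₁ ω ℓ ↔ (ℓ = ℓ₁ ∧ s(p, ℓ₁) ∈ ω) ∨ (ℓ ≠ ℓ₁ ∧ s(p, u) ∈ ω ∧ s(u, ℓ) ∈ ω) := by
  by_cases hl : ℓ = ℓ₁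
  · subst hl
    simp only [pocket, connU, hc, and_false, or_false, false_or, true_and, ne_eq, not_true_eq_false]
  · simp only [pocket, connU, hc, and_false, or_false, hl, false_and, ne_eq, not_false_eq_true, true_and, false_or]

/-- With `s(u,ℓ₁)` closed, the pocket count is `𝟙[s(p,ℓ₁)] + 𝟙[s(p,u)] · K_{Lf ∖ ℓ₁}`. [this work] -/
theorem pocket_card_of_c0 {ω : BondConfig (Fin n)} (hc : s(u, ℓ₁) ∉ ω) :
    (Lf.filter fun ℓ => pocket p u ℓ₁ ω ℓ).card =
      (if s(p, ℓ₁) ∈ ω then 1 else 0) +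
        (if s(p, u) ∈ ω then ((Lf.erase ℓ₁).filter fun ℓ => s(u, ℓ) ∈ ω).card else 0) := by
  have hLf : Lf = insert ℓ₁ (Lf.erase ℓ₁) := (insert_erase H.l1).symm
  conv_lhs => rw [hLf]
  rw [filter_insert]
  have hrest : ((Lf.erase ℓ₁).filter fun ℓ => pocket p u ℓ₁ ω ℓ) =
      if s(p, u) ∈ ω then (Lf.erase ℓ₁).filter fun ℓ => s(u, ℓ) ∈ ω else ∅ := by
    by_cases hpu : s(p, u) ∈ ω
    · rw [if_pos hpu]
      refine filter_congr fun ℓ hℓ => ?_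
      rw [pocket_iff_of_c0 H hc]
      have hne : ℓ ≠ ℓ₁ := (mem_erase.1 hℓ).1
      simp [hne, hpu]
    · rw [if_neg hpu, filter_eq_empty_iff]
      intro ℓ hℓ h
      rw [pocket_iff_of_c0 H hc] at h
      rcases h with ⟨h1, -⟩ | ⟨-, h2, -⟩
      · exact (mem_erase.1 hℓ).1 h1
      · exact hpu h2
  have h1iff : pocket p u ℓ₁ ω ℓ₁ ↔ s(p, ℓ₁) ∈ ω := by
    rw [pocket_iff_of_c0 H hc]; simp
  by_cases hp1 : s(p, ℓ₁) ∈ ω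
  · rw [if_pos (h1iff.2 hp1), if_pos hp1, card_insert_of_notMem (fun h => (notMem_erase ℓ₁ Lf) (mem_of_mem_filter _ h)), hrest]
    by_cases hpu : s(p, u) ∈ ω
    · rw [if_pos hpu, if_pos hpu]; omega
    · rw [if_neg hpu, if_neg hpu]; simp
  · rw [if_neg (fun h => hp1 (h1iff.1 h)), if_neg hp1, hrest]
    by_cases hpu : s(p, u) ∈ ω
    · rw [if_pos hpu, if_pos hpu]; omega
    · rw [if_neg hpu, if_neg hpu]; simp

/-- With `s(u,ℓ₁)` closed: `X ≥ 1 ↔ s(p,ℓ₁) open ∨ (s(p,u) open ∧ K_I ≥ 1)`. [this work] -/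
theorem one_le_pocket_card_iff_of_c0 {ω : BondConfig (Fin n)} (hc : s(u, ℓ₁) ∉ ω) :
    1 ≤ (Lf.filter fun ℓ => pocket p u ℓ₁ ω ℓ).card ↔
      s(p, ℓ₁) ∈ ω ∨ (s(p, ℓ₁) ∉ ω ∧ (s(p, u) ∈ ω ∧ 1 ≤ ((Lf.erase ℓ₁).filter fun ℓ => s(u, ℓ) ∈ ω).card)) := by
  rw [pocket_card_of_c0 H hc]
  by_cases hp1 : s(p, ℓ₁) ∈ ω
  · rw [if_pos hp1]; simp only [hp1, true_or, iff_true]; omega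
  · rw [if_neg hp1]
    by_cases hpu : s(p, u) ∈ ω
    · rw [if_pos hpu]; simp only [hp1, hpu, false_or, not_false_eq_true, true_and, zero_add]
    · rw [if_neg hpu]; simp only [hp1, hpu, false_or, false_and, and_false, iff_false, add_zero]; omega

/-- With `s(u,ℓ₁)` closed: `X ≥ 2 ↔ (s(p,ℓ₁), s(p,u) open ∧ K_I ≥ 1) ∨ (s(p,ℓ₁) closed ∧ s(p,u) open ∧ K_I ≥ 2)`. [this work] -/
theorem two_le_pocket_card_iff_of_c0 {ω : BondConfig (Fin n)} (hc : s(u, ℓ₁) ∉ ω) :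
    2 ≤ (Lf.filter fun ℓ => pocket p u ℓ₁ ω ℓ).card ↔
      (s(p, ℓ₁) ∈ ω ∧ (s(p, u) ∈ ω ∧ 1 ≤ ((Lf.erase ℓ₁).filter fun ℓ => s(u, ℓ) ∈ ω).card)) ∨
        (s(p, ℓ₁) ∉ ω ∧ (s(p, u) ∈ ω ∧ 2 ≤ ((Lf.erase ℓ₁).filter fun ℓ => s(u, ℓ) ∈ ω).card)) := by
  rw [pocket_card_of_c0 H hc]
  by_cases hp1 : s(p, ℓ₁) ∈ ω
  · rw [if_pos hp1]
    by_cases hpu : s(p, u) ∈ ω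
    · rw [if_pos hpu]; simp only [hp1, hpu, true_and, not_true_eq_false, false_and, or_false]; omega
    · rw [if_neg hpu]; simp only [hp1, hpu, false_and, and_false, not_true_eq_false, or_self, iff_false]; omega
  · rw [if_neg hp1]
    by_cases hpu : s(p, u) ∈ ω
    · rw [if_pos hpu]; simp only [hp1, hpu, false_and, not_false_eq_true, true_and, false_or, zero_add]
    · rw [if_neg hpu]; simp only [hp1, hpu, false_and, and_false, or_self, iff_false]; omega

/-- DETACHED: `P(X ≥ 1) = 1 − (1 − b)(1 − a (1 − z0 I q))`, `I = Lf ∖ ℓ₁`. [this work] -/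
theorem real_X1_of_c0 (hc : (v s(u, ℓ₁) : ℝ) = 0) :
    (prodBernoulli v).real {ω : BondConfig (Fin n) | 1 ≤ (Lf.filter fun ℓ => pocket p u ℓ₁ ω ℓ).card} =
      1 - (1 - (v s(p, ℓ₁) : ℝ)) * (1 - (v s(p, u) : ℝ) * (1 - z0 (Lf.erase ℓ₁) (fun ℓ => (v s(u, ℓ) : ℝ)))) := by
  have hmeas : ∀ U : Set (BondConfig (Fin n)), MeasurableSet U := fun U => (Set.toFinite U).measurableSet
  set I := Lf.erase ℓ₁ with hI
  have hIsub : I ⊆ Lf := erase_subset ℓ₁ Lf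
  have huI : u ∉ I := fun h => H.uL (hIsub h)
  set E1 : Set (BondConfig (Fin n)) := {ω | s(p, u) ∈ ω} ∩ {ω | 1 ≤ (I.filter fun ℓ => s(u, ℓ) ∈ ω).card} with hE1
  have h1 : (prodBernoulli v).real {ω : BondConfig (Fin n) | 1 ≤ (Lf.filter fun ℓ => pocket p u ℓ₁ ω ℓ).card} =
      (prodBernoulli v).real ({ω | s(p, ℓ₁) ∈ ω} ∪ ({ω | s(p, ℓ₁) ∉ ω} ∩ E1)) := by
    refine real_congr_of_null v hc _ _ fun ω hω => ?_
    simp only [mem_setOf_eq, Set.mem_inter_iff, Set.mem_union, hE1]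
    exact one_le_pocket_card_iff_of_c0 H hω
  have hdisj : Disjoint {ω : BondConfig (Fin n) | s(p, ℓ₁) ∈ ω} ({ω | s(p, ℓ₁) ∉ ω} ∩ E1) := by
    rw [Set.disjoint_left]; rintro ω h1 ⟨h2, -⟩; exact h2 h1
  have hdetE : DeterminedBy E1 (↑(insert s(p, u) (I.image fun ℓ => s(u, ℓ))) : Set (Sym2 (Fin n))) := by
    refine determinedBy_of_mem_iff fun ω ω' h => ?_
    have hpu := h _ (mem_insert_self _ _)
    have hfil : (I.filter fun ℓ => s(u, ℓ) ∈ ω) = (I.filter fun ℓ => s(u, ℓ) ∈ ω') :=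
      filter_congr fun ℓ hℓ => h _ (mem_insert_of_mem (mem_image_of_mem _ hℓ))
    simp only [hE1, Set.mem_inter_iff, mem_setOf_eq, hpu, hfil]
  have hl1 : s(p, ℓ₁) ∉ insert s(p, u) (I.image fun ℓ => s(u, ℓ)) := by
    rw [Finset.mem_insert, not_or]
    refine ⟨fun he => ?_, l1Pair_notMem_image H I hIsub⟩
    rcases Sym2.eq_iff.1 he with ⟨-, h2⟩ | ⟨h1, -⟩
    · exact H.uL (by rw [← h2]; exact H.l1)
    · exact H.pu h1
  rw [h1, measureReal_union hdisj (hmeas _), prodBernoulli_real_setOf_mem, real_notMem_inter v _ hl1 hdetE, hE1,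
    real_mem_inter v _ (parentPair_notMem_image H I hIsub) (determinedBy_count u I fun k => 1 ≤ k),
    real_count_ge_one_eq v u I huI]
  ring

/-- DETACHED: `P(X ≥ 2) = b · a (1 − z0 I q) + (1 − b) · a (1 − z0 I q − z1 I q)`. [this work] -/
theorem real_X2_of_c0 (hc : (v s(u, ℓ₁) : ℝ) = 0) :
    (prodBernoulli v).real {ω : BondConfig (Fin n) | 2 ≤ (Lf.filter fun ℓ => pocket p u ℓ₁ ω ℓ).card} =
      (v s(p, ℓ₁) : ℝ) * ((v s(p, u) : ℝ) * (1 - z0 (Lf.erase ℓ₁) (fun ℓ => (v s(u, ℓ) : ℝ)))) +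
        (1 - (v s(p, ℓ₁) : ℝ)) * ((v s(p, u) : ℝ) *
          (1 - z0 (Lf.erase ℓ₁) (fun ℓ => (v s(u, ℓ) : ℝ)) - z1 (Lf.erase ℓ₁) (fun ℓ => (v s(u, ℓ) : ℝ)))) := by
  have hmeas : ∀ U : Set (BondConfig (Fin n)), MeasurableSet U := fun U => (Set.toFinite U).measurableSet
  set I := Lf.erase ℓ₁ with hI
  have hIsub : I ⊆ Lf := erase_subset ℓ₁ Lf
  have huI : u ∉ I := fun h => H.uL (hIsub h)
  set E1 : Set (BondConfig (Fin n)) := {ω | s(p, u) ∈ ω} ∩ {ω | 1 ≤ (I.filter fun ℓ => s(u, ℓ) ∈ ω).card} with hE1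
  set E2 : Set (BondConfig (Fin n)) := {ω | s(p, u) ∈ ω} ∩ {ω | 2 ≤ (I.filter fun ℓ => s(u, ℓ) ∈ ω).card} with hE2
  have h1 : (prodBernoulli v).real {ω : BondConfig (Fin n) | 2 ≤ (Lf.filter fun ℓ => pocket p u ℓ₁ ω ℓ).card} =
      (prodBernoulli v).real (({ω | s(p, ℓ₁) ∈ ω} ∩ E1) ∪ ({ω | s(p, ℓ₁) ∉ ω} ∩ E2)) := by
    refine real_congr_of_null v hc _ _ fun ω hω => ?_
    simp only [mem_setOf_eq, Set.mem_inter_iff, Set.mem_union, hE1, hE2]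
    exact two_le_pocket_card_iff_of_c0 H hω
  have hdisj : Disjoint ({ω : BondConfig (Fin n) | s(p, ℓ₁) ∈ ω} ∩ E1) ({ω | s(p, ℓ₁) ∉ ω} ∩ E2) := by
    rw [Set.disjoint_left]; rintro ω ⟨h1, -⟩ ⟨h2, -⟩; exact h2 h1
  have hdetE : ∀ k : ℕ, DeterminedBy ({ω : BondConfig (Fin n) | s(p, u) ∈ ω} ∩ {ω | k ≤ (I.filter fun ℓ => s(u, ℓ) ∈ ω).card})
      (↑(insert s(p, u) (I.image fun ℓ => s(u, ℓ))) : Set (Sym2 (Fin n))) := by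
    intro k
    refine determinedBy_of_mem_iff fun ω ω' h => ?_
    have hpu := h _ (mem_insert_self _ _)
    have hfil : (I.filter fun ℓ => s(u, ℓ) ∈ ω) = (I.filter fun ℓ => s(u, ℓ) ∈ ω') :=
      filter_congr fun ℓ hℓ => h _ (mem_insert_of_mem (mem_image_of_mem _ hℓ))
    simp only [Set.mem_inter_iff, mem_setOf_eq, hpu, hfil]
  have hl1 : s(p, ℓ₁) ∉ insert s(p, u) (I.image fun ℓ => s(u, ℓ)) := by
    rw [Finset.mem_insert, not_or]
    refine ⟨fun he => ?_, l1Pair_notMem_image H I hIsub⟩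
    rcases Sym2.eq_iff.1 he with ⟨-, h2⟩ | ⟨h1, -⟩
    · exact H.uL (by rw [← h2]; exact H.l1)
    · exact H.pu h1
  rw [h1, measureReal_union hdisj (hmeas _), real_mem_inter v _ hl1 (hdetE 1), real_notMem_inter v _ hl1 (hdetE 2),
    real_mem_inter v _ (parentPair_notMem_image H I hIsub) (determinedBy_count u I fun k => 1 ≤ k),
    real_mem_inter v _ (parentPair_notMem_image H I hIsub) (determinedBy_count u I fun k => 2 ≤ k),
    real_count_ge_one_eq v u I huI, real_count_ge_two_eq v u I huI]

/-- DETACHED: `P(pocket ℓ₁) = b`. [this work] -/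
theorem real_pocket_l1_of_c0 (hc : (v s(u, ℓ₁) : ℝ) = 0) :
    (prodBernoulli v).real {ω : BondConfig (Fin n) | pocket p u ℓ₁ ω ℓ₁} = (v s(p, ℓ₁) : ℝ) := by
  have h1 : (prodBernoulli v).real {ω : BondConfig (Fin n) | pocket p u ℓ₁ ω ℓ₁} = (prodBernoulli v).real {ω | s(p, ℓ₁) ∈ ω} := by
    refine real_congr_of_null v hc _ _ fun ω hω => ?_
    simp only [mem_setOf_eq, pocket_iff_of_c0 H hω, true_and, ne_eq, not_true_eq_false, false_and, or_false]
  rw [h1, prodBernoulli_real_setOf_mem]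

/-- DETACHED: `P(pocket ℓ) = a · q ℓ` for `ℓ ∈ Lf ∖ ℓ₁`. [this work] -/
theorem real_pocket_of_c0 (hc : (v s(u, ℓ₁) : ℝ) = 0) {ℓ : Fin n} (hℓ : ℓ ∈ Lf.erase ℓ₁) :
    (prodBernoulli v).real {ω : BondConfig (Fin n) | pocket p u ℓ₁ ω ℓ} = (v s(p, u) : ℝ) * (v s(u, ℓ) : ℝ) := by
  have hne : ℓ ≠ ℓ₁ := (mem_erase.1 hℓ).1
  have hℓL : ℓ ∈ Lf := (mem_erase.1 hℓ).2
  have h1 : (prodBernoulli v).real {ω : BondConfig (Fin n) | pocket p u ℓ₁ ω ℓ} =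
      (prodBernoulli v).real ({ω | s(p, u) ∈ ω} ∩ {ω | s(u, ℓ) ∈ ω}) := by
    refine real_congr_of_null v hc _ _ fun ω hω => ?_
    simp only [mem_setOf_eq, Set.mem_inter_iff, pocket_iff_of_c0 H hω, hne, false_and, false_or, ne_eq, not_false_eq_true,
      true_and]
  have hne' : s(p, u) ∉ ({s(u, ℓ)} : Finset (Sym2 (Fin n))) := by
    rw [Finset.mem_singleton]
    intro he
    rcases Sym2.eq_iff.1 he with ⟨h1, -⟩ | ⟨h1, -⟩
    · exact H.pu h1
    · exact H.pL (by rw [h1]; exact hℓL)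
  rw [h1, real_mem_inter v _ hne' (var2083_det_mem _), prodBernoulli_real_setOf_mem]

end Pocket

end Bundle

end Quant

end Summit.CriticalPhenomena.PercolationContinuityZ3.Theorems
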